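import Summits.AtomisticToContinuum.FouriersLaw.Theses.BondHeatUncertainty
import Summits.AtomisticToContinuum.FouriersLaw.Theses.BoundaryEscapeDeficit
import Summits.AtomisticToContinuum.FouriersLaw.Theorems.BondHeatUncertaintySubdiffusiveBondHeatGibbsMomentumFourthMoment
import Summits.AtomisticToContinuum.FouriersLaw.Theorems.BondHeatUncertaintySubdiffusiveBondHeatGibbsPositionEighthMoment
import Summits.AtomisticToContinuum.FouriersLaw.Theorems.BondHeatUncertaintySubdiffusiveBondHeatBathBondReductionConditional

/-!
# Line `bath-bond-deficit-integral` — crux `BondHeatUncertainty.SubdiffusiveBondHeat` (stmt-AtomisticToContinuum-9120)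

Lead prover's skeleton (reshaped from the crux-plan skeleton of the same name, round 1, triage r1-1:
pass; lead `prover-line-stmt-AtomisticToContinuum-9120-lean-0`, 2026-08-16). The crux (S) asks, for the
pinned anharmonic chain `P = pinnedChain ω₂ lam β γ` (all parameters `> 0`) with both Langevin baths at
temperature `T > 0`, for an `N`-uniform Edwards–Wilkinson bound `V_N(b,t) ≤ A √t` on the equilibrium
BOND-HEAT VARIANCE `V_N(b,t) = 2∫₀ᵗ (t-s) C_N(b,s) ds` (`C_N(b,s) = ∫ j_b · (P_s j_b) dμ_T`) of ONE bond `b`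
of the prover's choice, for `1 ≤ t ≤ c N²`, `N ≥ N₀`.

**The line.** Take the bath bond `b = 0`. Energy balance at site `0`,
`d e₀ = -j₀ dt + dQ^L` with `e₀ = p₀²/2 + U(q₀) + ½ V(q₁ - q₀)` and the left-bath heat
`dQ^L = γ (T - p₀²) dt + √(2γT) p₀ dW`, gives pathwise `∫₀ᵗ j₀ = Q^L_t - Δe₀`; the EXACT equilibrium identity
`Var_eq(Q^L_t) = 2γT² ∫₀ᵗ (1 - θ_N(s)) ds`, `θ_N(t) = (γ/T²) ∫₀ᵗ K_N`, `K_N(u) = ⟨p₀² - T, P_u(p₀² - T)⟩_{μ_T}`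
(VERBATIM the objects of route `BoundaryEscapeDeficit`) converts (S) at `b = 0` into a bound on the
once-integrated ESCAPE-DEFICIT CURVE: `V_N(0,t) ≤ 4γT² ∫₀ᵗ (1 - θ_N) + 8 E_{μ_T}[e₀²]`, and the deficit curve
splits EXACTLY into its Ohmic floor and its relaxation transient, `1 - θ_N(s) = E_N + (γ/T²) ∫_s^∞ K_N`.

**Reshape (lead, L1).** The registered stubs are now stated over TREE VOCABULARY ONLY (no local `def` in a
stub signature), so that each can be landed verbatim from a `Theorems/` file that imports only the two route
modules; the local `def`s below are abbreviations used by the sorry-free composition, bridged to the stubs by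
`dif_pos` unfolding. The static stub of the plan (`E_{μ_T}[e₀²] ≤ σ²` uniformly in `N`) is split into its two
honest halves — the exact Gaussian momentum moment and the uniform one-site POSITION moments of the
one-dimensional Gibbs state — and their composition `siteEnergyMoment_le_of_moments` is proved here.

**Stubs** (sorried, registered; RESHAPED 2026-08-16 by the re-seated lead: `stub_bathBondReduction` is now derived
from (H2) `stub_kernelDetailedBalance`, (H3) `stub_siteEnergyDynkin`, (H4) `stub_siteEnergyCurrentCovariance` via the
landed conditional `stub_bathBondReduction_of_kernelFacts`; both static stubs are landed):
* `stub_bathBondReduction` — FIXED `N ≥ 2`, every `t ≥ 0`: `V_N(0,t) ≤ 4γT² ∫₀ᵗ (1 - θ_N) + 8 E_{μ_T}[e₀²]`;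
  size L–XL (kernel-level variance calculus for the constructed Markov kernels: Gibbs invariance
  `μ_T P_t = μ_T` = `BoundaryEscapeDeficit.BoundaryKernelBasics` (a), Markov property, Dynkin for polynomial
  observables, `Θ`-reversibility at `T_L = T_R`).
* `stub_gibbsMomentumFourthMoment` — STATICS, exact: `p₀` is `N(0,T)` under `μ_T^N`, so `∫ p₀⁴ dμ_T^N ≤ 3T²`
  (with integrability), every `N ≥ 1`; size M (Fubini on `(Fin N → ℝ) × (Fin N → ℝ)`, Gaussian moments).
* `stub_gibbsPositionEighthMoment` — STATICS, `N`-uniform: `∫ q₀⁸ dμ_T^N, ∫ q₁⁸ dμ_T^N ≤ C` for all `N ≥ 2`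
  (with integrability); size L. Route: every one-site marginal of the 1-D Gibbs state with EVEN CONVEX `U, V`
  is `e^{-U/T} ×` (a symmetric unimodal factor) — Wintner: the convolution of two even functions
  non-increasing on `[0,∞)` is again such, applied along the transfer recursion
  `h_n = e^{-U/T} · (e^{-V/T} * h_{n-1})` — so by Chebyshev's covariance inequality (`a^{2k}` symmetric
  increasing vs. the symmetric unimodal factor, under the even measure `e^{-U/T} da`)
  `E_N[q_i^{2k}] ≤ ∫ a^{2k} e^{-U(a)/T} da / ∫ e^{-U/T}` uniformly in `N` and `i`.
* `stub_ohmicFloor` — `N`-UNIFORM, transport: `E_N ≤ C₁/N` for `N ≥ N₀` (Ohm's law at the contact as an UPPER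
  bound; bounded response seen from the thermostatted site; shared verbatim with `BoundaryEscapeDeficit`:
  implied by `EscapeLaw`, and by the upper halves of `HalfChainTailLaw` + `DiffusiveCrossover` — bridges
  `ohmicFloor_of_escapeLaw`, `ohmicFloor_of_tail_crossover` below); size XL (open). The barrier
  `HasBoundedResponse` is met head-on here, as the card declares — not evaded.
* `stub_transientEW` — `N`-UNIFORM, fluctuation: `∫₀ᵗ (1 - θ_N(s) - E_N) ds ≤ C₂ √t` for `1 ≤ t ≤ c N²`,
  `N ≥ N₀` — the Edwards–Wilkinson ¼-law of the RELAXATION part of the bath heat; size XL, the line's own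
  load-bearing stub (held by the lead).

Composition (sorry-free): `siteEnergyMoment_le_of_moments` (the two static stubs ⇒ `E[e₀²] ≤ 3T²/2 + …`),
`deficitIntegral_le_of_floor_transient` (floor + transient ⇒ Cesàro deficit bound on the window),
`bondHeatVar_le_of_parts`, and `SubdiffusiveBondHeat_of`, which concludes the crux BY NAME (witness `b = 0`;
the crux's `let V` is `bondHeatVar` definitionally).

Disproof.lean: none exists for this crux (2026-08-16T00:30Z; `ledger crux ls`): nothing to honour yet.
Calibration: at the harmonic member (`lam = β = 0`, outside the crux's range) every stub but `stub_ohmicFloor`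
is expected to hold (`E_N → E^harm > 0`, Rieder–Lebowitz–Lieb) — exactly where (S) fails; kit j007496/j007530
(planner) confirm the fixed-`N` identity behind `stub_bathBondReduction` to quadrature accuracy.
-/

noncomputable section

open MeasureTheory Set Filter Topology

namespace Summit.AtomisticToContinuum.FouriersLaw.Cruxes.SubdiffusiveBondHeat.BathBondDeficitIntegral

open Literature.MathematicalPhysics.KineticTheory.HeatConduction (pinnedChain PhaseSpace)
open Summit.AtomisticToContinuum.FouriersLaw.Theses.BondHeatUncertainty (SubdiffusiveBondHeat)
open Summit.AtomisticToContinuum.FouriersLaw.Theses.BoundaryEscapeDeficit (EscapeLaw HalfChainTailLaw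
  DiffusiveCrossover)

/-! ## The objects (verbatim the `let`s of the crux and of route `BoundaryEscapeDeficit`) -/

/-- `C_N(b,s) = ∫ j_b(z) · (P_s j_b)(z) dμ_T^N(z)`: the equilibrium autocorrelation of the energy current through
bond `(b, b+1)` of the `N`-site chain with both baths at `T` (constructed kernels; `0` if `b ≥ N`). Verbatim the
`let C` of `BondHeatUncertainty.SubdiffusiveBondHeat`. -/
def bondCorr (ω₂ lam β γ T : ℝ) (N b : ℕ) (s : ℝ) : ℝ :=
  if h : b < N then
    ∫ z, (pinnedChain ω₂ lam β γ).bondCurrent N ⟨b, h⟩ z *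
        (∫ y, (pinnedChain ω₂ lam β γ).bondCurrent N ⟨b, h⟩ y
          ∂((pinnedChain ω₂ lam β γ).transitionKernel N T T s.toNNReal z))
      ∂((pinnedChain ω₂ lam β γ).gibbsMeasure N T)
  else 0

/-- `V_N(b,t) = 2 ∫₀ᵗ (t - s) C_N(b,s) ds`: the equilibrium variance of the heat `Q_t^{(b)} = ∫₀ᵗ j_b` through bond
`(b, b+1)`. Verbatim the `let V` of the crux. -/
def bondHeatVar (ω₂ lam β γ T : ℝ) (N b : ℕ) (t : ℝ) : ℝ :=
  2 * ∫ s in (0 : ℝ)..t, (t - s) * bondCorr ω₂ lam β γ T N b s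

/-- `K_N(u) = ∫ (p₀² - T) · P_u(p₀² - T) dμ_T^N`: the boundary kinetic-temperature autocorrelation. Verbatim the
`let K` of route `BoundaryEscapeDeficit` (`HalfChainTailLaw`, `DiffusiveCrossover`, `ResponseIdentity`, …). -/
def kinCorr (ω₂ lam β γ T : ℝ) (N : ℕ) (u : ℝ) : ℝ :=
  if h : 0 < N then
    ∫ z, ((z.2 ⟨0, h⟩) ^ 2 - T) *
        (∫ y, ((y.2 ⟨0, h⟩) ^ 2 - T) ∂((pinnedChain ω₂ lam β γ).transitionKernel N T T u.toNNReal z))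
      ∂((pinnedChain ω₂ lam β γ).gibbsMeasure N T)
  else 0

/-- `θ_N(t) = (γ/T²) ∫₀ᵗ K_N(u) du`: the normalised step response of `⟨p₀²⟩` to the left bath temperature
(`1 - θ_N` = the escape-deficit curve). Verbatim the `let θ` of route `BoundaryEscapeDeficit`. -/
def stepResponse (ω₂ lam β γ T : ℝ) (N : ℕ) (t : ℝ) : ℝ :=
  γ / T ^ 2 * ∫ u in (0 : ℝ)..t, kinCorr ω₂ lam β γ T N u

/-- `E_N = 1 - θ_N(∞) = 1 - (γ/T²) ∫₀^∞ K_N`: the ESCAPE DEFICIT, the Ohmic floor of the deficit curve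
(`D_N = (N-1) γ E_N` is `BoundaryEscapeDeficit.ResponseIdentity`). Verbatim the `let E` of that route. -/
def escapeDeficit (ω₂ lam β γ T : ℝ) (N : ℕ) : ℝ :=
  1 - γ / T ^ 2 * ∫ u in Set.Ioi (0 : ℝ), kinCorr ω₂ lam β γ T N u

/-- `∫₀ᵗ (1 - θ_N(s)) ds` — by the bath-heat variance identity this is `Var_eq(Q^L_t) / (2γT²)`. -/
def deficitIntegral (ω₂ lam β γ T : ℝ) (N : ℕ) (t : ℝ) : ℝ :=
  ∫ s in (0 : ℝ)..t, (1 - stepResponse ω₂ lam β γ T N s)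

/-- `∫₀ᵗ (1 - θ_N(s) - E_N) ds = (γ/T²) ∫₀ᵗ ∫_s^∞ K_N(u) du ds`: the once-integrated RELAXATION TRANSIENT of the
step response (deficit curve minus its Ohmic floor). -/
def transientIntegral (ω₂ lam β γ T : ℝ) (N : ℕ) (t : ℝ) : ℝ :=
  ∫ s in (0 : ℝ)..t, (1 - stepResponse ω₂ lam β γ T N s - escapeDeficit ω₂ lam β γ T N)

/-- The local energy at the bath site, `e₀ = p₀²/2 + U(q₀) + ½ V(q₁ - q₀)` (`0` on chains with fewer than two
sites): `d e₀/dt |_Hamiltonian = -j₀` for the tree's symmetric bond current `j₀ = -½ (p₀ + p₁) V'(q₁ - q₀)`. -/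
def siteEnergy₀ (ω₂ lam β γ : ℝ) (N : ℕ) (z : PhaseSpace N) : ℝ :=
  if h : 1 < N then
    (z.2 ⟨0, Nat.zero_lt_of_lt h⟩) ^ 2 / 2 + (pinnedChain ω₂ lam β γ).U (z.1 ⟨0, Nat.zero_lt_of_lt h⟩) +
      (pinnedChain ω₂ lam β γ).V (z.1 ⟨1, h⟩ - z.1 ⟨0, Nat.zero_lt_of_lt h⟩) / 2
  else 0

/-- `E_{μ_T^N}[e₀²]`: second moment of the bath-site energy under the Gibbs measure. -/
def siteEnergyMoment (ω₂ lam β γ T : ℝ) (N : ℕ) : ℝ :=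
  ∫ z, (siteEnergy₀ ω₂ lam β γ N z) ^ 2 ∂((pinnedChain ω₂ lam β γ).gibbsMeasure N T)

/-! ## Def-level statements (abbreviations; the REGISTERED stubs below spell them out) -/

/-- `V_N(0,t) ≤ 4γT² ∫₀ᵗ (1 - θ_N(s)) ds + 8 E_{μ_T}[e₀²]` for `N ≥ 2`, `t ≥ 0`. -/
def BathBondReduction : Prop :=
  ∀ ω₂ lam β γ : ℝ, 0 < ω₂ → 0 < lam → 0 < β → 0 < γ → ∀ T : ℝ, 0 < T →
    ∀ N : ℕ, 2 ≤ N → ∀ t : ℝ, 0 ≤ t →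
      bondHeatVar ω₂ lam β γ T N 0 t ≤
        4 * γ * T ^ 2 * deficitIntegral ω₂ lam β γ T N t + 8 * siteEnergyMoment ω₂ lam β γ T N

/-- `E_{μ_T^N}[e₀²] ≤ σ²` for all `N ≥ 2`. -/
def LocalEnergyMoment : Prop :=
  ∀ ω₂ lam β γ : ℝ, 0 < ω₂ → 0 < lam → 0 < β → 0 < γ → ∀ T : ℝ, 0 < T →
    ∃ σ2 : ℝ, ∀ N : ℕ, 2 ≤ N → siteEnergyMoment ω₂ lam β γ T N ≤ σ2

/-- `E_N ≤ C₁ / N` for all `N ≥ N₀`. As stated it also asserts, implicitly, `K_N ∈ L¹(0,∞)` for large `N`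
(else the Bochner integral is `0` and `E_N = 1`). False at the harmonic member. -/
def OhmicFloor : Prop :=
  ∀ ω₂ lam β γ : ℝ, 0 < ω₂ → 0 < lam → 0 < β → 0 < γ → ∀ T : ℝ, 0 < T →
    ∃ C₁ : ℝ, ∃ N₀ : ℕ, ∀ N : ℕ, N₀ ≤ N → escapeDeficit ω₂ lam β γ T N ≤ C₁ / (N : ℝ)

/-- `∫₀ᵗ (1 - θ_N(s) - E_N) ds ≤ C₂ √t` for `1 ≤ t ≤ c N²`, `N ≥ N₀`. -/
def TransientEW : Prop :=
  ∀ ω₂ lam β γ : ℝ, 0 < ω₂ → 0 < lam → 0 < β → 0 < γ → ∀ T : ℝ, 0 < T →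
    ∃ C₂ c : ℝ, 0 < c ∧ ∃ N₀ : ℕ, ∀ N : ℕ, N₀ ≤ N → ∀ t : ℝ, 1 ≤ t → t ≤ c * (N : ℝ) ^ 2 →
      transientIntegral ω₂ lam β γ T N t ≤ C₂ * Real.sqrt t

/-! ## Registered stubs (signatures over tree vocabulary only) -/

/-- **Stub (H2)** (fixed `N ≥ 2`, size XL — the line's fixed-`N` blocker after the reshape of 2026-08-16): DETAILED BALANCE
of the constructed kernels under momentum reversal `Θ(q,p) = (q,-p)`, weak `L²(μ_T)` form:
`∫ f · (P_s h) dμ_T = ∫ (h∘Θ) · P_s (f∘Θ) dμ_T` for measurable `f, h` with `f², h² ∈ L¹(μ_T)` — the generalised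
detailed balance `L† = ΘLΘ` of the equilibrium Langevin dynamics (time reversal of the stationary kernel process is
the momentum-flipped process). Route: Doob `e^{-H/T}`-transform of the Lebesgue duality
`dx P_t(x,dy) = e^{2γt} dy P̂_t(y,dx)` (`LangevinChainReversal`) using `P̂_t e^{-H/T} = e^{-2γt}e^{-H/T}`
(`…KernelGibbsC`), then identification of the transformed reversed semigroup with the flipped forward one (common
generator `ΘLΘ`; needs a Girsanov-type change of drift `2γ 1_B p` in the noise directions, or uniqueness for the
Kolmogorov equation). Hypothesis (H2) of the landed conditional reduction `stub_bathBondReduction_of_kernelFacts`. -/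
theorem stub_kernelDetailedBalance :
    ∀ ω₂ lam β γ : ℝ, 0 < ω₂ → 0 < lam → 0 < β → 0 < γ → ∀ T : ℝ, 0 < T → ∀ (N : ℕ) (hN : 1 < N),
      ∀ (s : NNReal) (f h : PhaseSpace N → ℝ), Measurable f → Measurable h →
        Integrable (fun y => f y ^ 2) ((pinnedChain ω₂ lam β γ).gibbsMeasure N T) →
        Integrable (fun y => h y ^ 2) ((pinnedChain ω₂ lam β γ).gibbsMeasure N T) →
        ∫ y, f y * (∫ y', h y' ∂((pinnedChain ω₂ lam β γ).transitionKernel N T T s) y)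
            ∂((pinnedChain ω₂ lam β γ).gibbsMeasure N T) =
          ∫ y, h (y.1, -y.2) * (∫ y', f (y'.1, -y'.2) ∂((pinnedChain ω₂ lam β γ).transitionKernel N T T s) y)
            ∂((pinnedChain ω₂ lam β γ).gibbsMeasure N T) := by
  sorry

/-- **Stub (H3)** (fixed `N ≥ 2`, size L): DYNKIN'S IDENTITY for the polynomially growing bath-site energy
`e₀ = p₀²/2 + U(q₀) + ½V(q₁ - q₀)` along the constructed kernels: `P_r e₀(z) - e₀(z) = ∫₀ʳ P_s(L e₀)(z) ds` with
`L e₀ = γ(T - p₀²) - j₀` (pointwise generator identity `pinnedChain_generator_siteEnergy`, landed). The tree has Dynkin on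
`C_c^∞` (`pinnedChain_dynkin`); the extension is the truncation `e₀ χ(H/R)` + exponential moments of `P_s(z,·)` (the
technique of `…KernelGibbsB/C`). Hypothesis (H3) of `stub_bathBondReduction_of_kernelFacts`. -/
theorem stub_siteEnergyDynkin :
    ∀ ω₂ lam β γ : ℝ, 0 < ω₂ → 0 < lam → 0 < β → 0 < γ → ∀ T : ℝ, 0 < T → ∀ (N : ℕ) (hN : 1 < N),
      ∀ (r : NNReal) (z : PhaseSpace N),
        ∫ y, ((y.2 ⟨0, Nat.zero_lt_of_lt hN⟩) ^ 2 / 2 + (pinnedChain ω₂ lam β γ).U (y.1 ⟨0, Nat.zero_lt_of_lt hN⟩) +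
              (pinnedChain ω₂ lam β γ).V (y.1 ⟨1, hN⟩ - y.1 ⟨0, Nat.zero_lt_of_lt hN⟩) / 2)
            ∂((pinnedChain ω₂ lam β γ).transitionKernel N T T r z) -
          ((z.2 ⟨0, Nat.zero_lt_of_lt hN⟩) ^ 2 / 2 + (pinnedChain ω₂ lam β γ).U (z.1 ⟨0, Nat.zero_lt_of_lt hN⟩) +
            (pinnedChain ω₂ lam β γ).V (z.1 ⟨1, hN⟩ - z.1 ⟨0, Nat.zero_lt_of_lt hN⟩) / 2) =
        ∫ s in (0 : ℝ)..(r : ℝ), ∫ y, (γ * (T - (y.2 ⟨0, Nat.zero_lt_of_lt hN⟩) ^ 2) -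
            (pinnedChain ω₂ lam β γ).bondCurrent N ⟨0, Nat.zero_lt_of_lt hN⟩ y)
          ∂((pinnedChain ω₂ lam β γ).transitionKernel N T T s.toNNReal z) := by
  sorry

/-- **Stub (H4)** (statics, size M): the static Gibbs inequality `∫ e₀ (j₀ - γ(T - p₀²)) dμ_T ≤ γT²` (true with
EQUALITY: `⟨e₀ j₀⟩ = 0` by momentum parity, `⟨F(q)(T - p₀²)⟩ = 0` by the Gaussian integration by parts
`⟨F(q) p₀²⟩ = T⟨F(q)⟩`, and `⟨(p₀²/2)(T - p₀²)⟩ = (T² - 3T²)/2 = -T²`). Hypothesis (H4) of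
`stub_bathBondReduction_of_kernelFacts`. -/
theorem stub_siteEnergyCurrentCovariance :
    ∀ ω₂ lam β γ : ℝ, 0 < ω₂ → 0 < lam → 0 < β → 0 < γ → ∀ T : ℝ, 0 < T → ∀ (N : ℕ) (hN : 1 < N),
      ∫ y, ((y.2 ⟨0, Nat.zero_lt_of_lt hN⟩) ^ 2 / 2 + (pinnedChain ω₂ lam β γ).U (y.1 ⟨0, Nat.zero_lt_of_lt hN⟩) +
            (pinnedChain ω₂ lam β γ).V (y.1 ⟨1, hN⟩ - y.1 ⟨0, Nat.zero_lt_of_lt hN⟩) / 2) *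
          ((pinnedChain ω₂ lam β γ).bondCurrent N ⟨0, Nat.zero_lt_of_lt hN⟩ y -
            γ * (T - (y.2 ⟨0, Nat.zero_lt_of_lt hN⟩) ^ 2)) ∂((pinnedChain ω₂ lam β γ).gibbsMeasure N T) ≤
        γ * T ^ 2 := by
  sorry

/-- **Bath-bond reduction** (fixed `N ≥ 2`; formerly `stub_bathBondReduction`, RESHAPED 2026-08-16): the inequality
`V_N(0,t) ≤ 4γT² ∫₀ᵗ (1 - (γ/T²)∫₀ˢ K_N) ds + 8 E_{μ_T^N}[e₀²]` for every `t ≥ 0`, now DERIVED from the three stubs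
(H2) `stub_kernelDetailedBalance`, (H3) `stub_siteEnergyDynkin`, (H4) `stub_siteEnergyCurrentCovariance` through the
landed conditional theorem `stub_bathBondReduction_of_kernelFacts` (p76677; Kundu–Dhar–Narayan argument run at the
kernel level, kernel Gibbs invariance consumed from `pinnedChain_gibbsMeasure_bind_transitionKernel`). -/
theorem stub_bathBondReduction :
    ∀ ω₂ lam β γ : ℝ, 0 < ω₂ → 0 < lam → 0 < β → 0 < γ → ∀ T : ℝ, 0 < T →
      ∀ (N : ℕ) (hN : 1 < N) (t : ℝ), 0 ≤ t →
        2 * (∫ s in (0 : ℝ)..t, (t - s) *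
            ∫ z, (pinnedChain ω₂ lam β γ).bondCurrent N ⟨0, Nat.zero_lt_of_lt hN⟩ z *
                (∫ y, (pinnedChain ω₂ lam β γ).bondCurrent N ⟨0, Nat.zero_lt_of_lt hN⟩ y
                  ∂((pinnedChain ω₂ lam β γ).transitionKernel N T T s.toNNReal z))
              ∂((pinnedChain ω₂ lam β γ).gibbsMeasure N T)) ≤
          4 * γ * T ^ 2 * (∫ s in (0 : ℝ)..t, (1 - γ / T ^ 2 * ∫ u in (0 : ℝ)..s,
              ∫ z, ((z.2 ⟨0, Nat.zero_lt_of_lt hN⟩) ^ 2 - T) *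
                  (∫ y, ((y.2 ⟨0, Nat.zero_lt_of_lt hN⟩) ^ 2 - T)
                    ∂((pinnedChain ω₂ lam β γ).transitionKernel N T T u.toNNReal z))
                ∂((pinnedChain ω₂ lam β γ).gibbsMeasure N T))) +
            8 * ∫ z, ((z.2 ⟨0, Nat.zero_lt_of_lt hN⟩) ^ 2 / 2 +
                (pinnedChain ω₂ lam β γ).U (z.1 ⟨0, Nat.zero_lt_of_lt hN⟩) +
                (pinnedChain ω₂ lam β γ).V (z.1 ⟨1, hN⟩ - z.1 ⟨0, Nat.zero_lt_of_lt hN⟩) / 2) ^ 2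
              ∂((pinnedChain ω₂ lam β γ).gibbsMeasure N T) :=
  fun ω₂ lam β γ hω hl hβ hγ T hT N hN t ht =>
    Summit.AtomisticToContinuum.FouriersLaw.Theorems.SubdiffusiveBondHeat.stub_bathBondReduction_of_kernelFacts
      ω₂ lam β γ hω hl hβ hγ T hT N hN
      (stub_kernelDetailedBalance ω₂ lam β γ hω hl hβ hγ T hT N hN)
      (stub_siteEnergyDynkin ω₂ lam β γ hω hl hβ hγ T hT N hN)
      (stub_siteEnergyCurrentCovariance ω₂ lam β γ hω hl hβ hγ T hT N hN) t ht

/-- **Stub** (statics, size M): the bath-site momentum is exactly Gaussian `N(0,T)` under the Gibbs state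
`μ_T^N = Z⁻¹ e^{-H/T} dq dp` (`H = ∑ p_i²/2 + Φ(q)`, product structure), so its fourth moment is `3T²`; stated as
integrability plus the bound `∫ p₀⁴ dμ_T^N ≤ 3T²`, for every `N ≥ 1` and `T > 0`. -/
theorem stub_gibbsMomentumFourthMoment :
    ∀ ω₂ lam β γ : ℝ, 0 < ω₂ → 0 < lam → 0 < β → 0 < γ → ∀ T : ℝ, 0 < T →
      ∀ (N : ℕ) (hN : 0 < N),
        Integrable (fun z : PhaseSpace N => (z.2 ⟨0, hN⟩) ^ 4) ((pinnedChain ω₂ lam β γ).gibbsMeasure N T) ∧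
        ∫ z, (z.2 ⟨0, hN⟩) ^ 4 ∂((pinnedChain ω₂ lam β γ).gibbsMeasure N T) ≤ 3 * T ^ 2 :=
  -- LANDED (p73996): Theorems/BondHeatUncertaintySubdiffusiveBondHeatGibbsMomentumFourthMoment.lean
  Summit.AtomisticToContinuum.FouriersLaw.Theorems.SubdiffusiveBondHeat.stub_gibbsMomentumFourthMoment

/-- **Stub** (statics, size L, `N`-uniform): uniform eighth moments of the positions at the two sites of the
bath bond under the Gibbs state of the pinned chain: there is `C` with `∫ q₀⁸ dμ_T^N ≤ C` and `∫ q₁⁸ dμ_T^N ≤ C`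
(with integrability) for every `N ≥ 2`. One-dimensional Gibbs state with even convex pinning
`U(q) = ω₂q²/2 + lam q⁴/4` and coupling `V(r) = r²/2 + βr⁴/4`: each one-site marginal is `e^{-U/T}` times a
symmetric unimodal factor (transfer recursion + Wintner's lemma), whence `E_N[q_i⁸] ≤ ∫ a⁸e^{-U(a)/T}da/∫e^{-U/T}`
by Chebyshev's covariance inequality. -/
theorem stub_gibbsPositionEighthMoment :
    ∀ ω₂ lam β γ : ℝ, 0 < ω₂ → 0 < lam → 0 < β → 0 < γ → ∀ T : ℝ, 0 < T →
      ∃ C : ℝ, ∀ (N : ℕ) (hN : 1 < N),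
        Integrable (fun z : PhaseSpace N => (z.1 ⟨0, Nat.zero_lt_of_lt hN⟩) ^ 8)
            ((pinnedChain ω₂ lam β γ).gibbsMeasure N T) ∧
        Integrable (fun z : PhaseSpace N => (z.1 ⟨1, hN⟩) ^ 8) ((pinnedChain ω₂ lam β γ).gibbsMeasure N T) ∧
        ∫ z, (z.1 ⟨0, Nat.zero_lt_of_lt hN⟩) ^ 8 ∂((pinnedChain ω₂ lam β γ).gibbsMeasure N T) ≤ C ∧
        ∫ z, (z.1 ⟨1, hN⟩) ^ 8 ∂((pinnedChain ω₂ lam β γ).gibbsMeasure N T) ≤ C :=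
  -- LANDED (p76468): Theorems/BondHeatUncertaintySubdiffusiveBondHeatGibbsPositionEighthMoment.lean
  Summit.AtomisticToContinuum.FouriersLaw.Theorems.SubdiffusiveBondHeat.stub_gibbsPositionEighthMoment

/-- **Stub** (`N`-uniform, size XL, shared with `BoundaryEscapeDeficit`): Ohmic floor `E_N = O(1/N)`, with
`E_N = 1 - (γ/T²) ∫₀^∞ K_N` VERBATIM the sibling route's `let E`. -/
theorem stub_ohmicFloor :
    ∀ ω₂ lam β γ : ℝ, 0 < ω₂ → 0 < lam → 0 < β → 0 < γ → ∀ T : ℝ, 0 < T →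
      ∃ C₁ : ℝ, ∃ N₀ : ℕ, ∀ N : ℕ, N₀ ≤ N →
        1 - γ / T ^ 2 * (∫ u in Set.Ioi (0 : ℝ),
          if h : 0 < N then
            ∫ z, ((z.2 ⟨0, h⟩) ^ 2 - T) *
                (∫ y, ((y.2 ⟨0, h⟩) ^ 2 - T) ∂((pinnedChain ω₂ lam β γ).transitionKernel N T T u.toNNReal z))
              ∂((pinnedChain ω₂ lam β γ).gibbsMeasure N T)
          else 0) ≤ C₁ / (N : ℝ) := by
  sorry

/-- **Stub** (`N`-uniform, size XL, load-bearing, held by the lead): Edwards–Wilkinson law of the bath-heat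
transient up to the Thouless time, `∫₀ᵗ (1 - θ_N(s) - E_N) ds ≤ C₂ √t` on `1 ≤ t ≤ cN²`, `N ≥ N₀`, with
`θ_N`, `E_N` VERBATIM the sibling route's `let θ`, `let E`. -/
theorem stub_transientEW :
    ∀ ω₂ lam β γ : ℝ, 0 < ω₂ → 0 < lam → 0 < β → 0 < γ → ∀ T : ℝ, 0 < T →
      ∃ C₂ c : ℝ, 0 < c ∧ ∃ N₀ : ℕ, ∀ N : ℕ, N₀ ≤ N → ∀ t : ℝ, 1 ≤ t → t ≤ c * (N : ℝ) ^ 2 →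
        (∫ s in (0 : ℝ)..t,
          (1 - γ / T ^ 2 * (∫ u in (0 : ℝ)..s,
              if h : 0 < N then
                ∫ z, ((z.2 ⟨0, h⟩) ^ 2 - T) *
                    (∫ y, ((y.2 ⟨0, h⟩) ^ 2 - T)
                      ∂((pinnedChain ω₂ lam β γ).transitionKernel N T T u.toNNReal z))
                  ∂((pinnedChain ω₂ lam β γ).gibbsMeasure N T)
              else 0) -
            (1 - γ / T ^ 2 * (∫ u in Set.Ioi (0 : ℝ),
              if h : 0 < N then
                ∫ z, ((z.2 ⟨0, h⟩) ^ 2 - T) *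
                    (∫ y, ((y.2 ⟨0, h⟩) ^ 2 - T)
                      ∂((pinnedChain ω₂ lam β γ).transitionKernel N T T u.toNNReal z))
                  ∂((pinnedChain ω₂ lam β γ).gibbsMeasure N T)
              else 0)))) ≤ C₂ * Real.sqrt t := by
  sorry

/-! ## Bridges: the registered stubs give the def-level statements -/

/-- `stub_bathBondReduction` in def form. -/
theorem bathBondReduction_holds : BathBondReduction := by
  intro ω₂ lam β γ hω hl hβ hγ T hT N hN t ht
  have h1 : 1 < N := hN
  have h0 : 0 < N := Nat.zero_lt_of_lt h1
  have h := stub_bathBondReduction ω₂ lam β γ hω hl hβ hγ T hT N h1 t ht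
  simp only [bondHeatVar, bondCorr, deficitIntegral, stepResponse, kinCorr, siteEnergyMoment, siteEnergy₀,
    dif_pos h0, dif_pos h1]
  exact h

/-- `stub_ohmicFloor` in def form. -/
theorem ohmicFloor_holds : OhmicFloor := by
  intro ω₂ lam β γ hω hl hβ hγ T hT
  obtain ⟨C₁, N₀, h⟩ := stub_ohmicFloor ω₂ lam β γ hω hl hβ hγ T hT
  refine ⟨C₁, N₀, fun N hN => ?_⟩
  have h' := h N hN
  simp only [escapeDeficit, kinCorr]
  exact h'

/-- `stub_transientEW` in def form. -/
theorem transientEW_holds : TransientEW := by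
  intro ω₂ lam β γ hω hl hβ hγ T hT
  obtain ⟨C₂, c, hc, N₀, h⟩ := stub_transientEW ω₂ lam β γ hω hl hβ hγ T hT
  refine ⟨C₂, c, hc, N₀, fun N hN t ht htc => ?_⟩
  have h' := h N hN t ht htc
  simp only [transientIntegral, stepResponse, escapeDeficit, kinCorr]
  exact h'

/-! ## Statics: the two moment stubs give the uniform bath-site energy moment -/

/-- Square of a sum of four reals. -/
theorem sq_add_four_le (w x y z : ℝ) : (w + x + y + z) ^ 2 ≤ 4 * (w ^ 2 + x ^ 2 + y ^ 2 + z ^ 2) := by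
  have key : 4 * (w ^ 2 + x ^ 2 + y ^ 2 + z ^ 2) - (w + x + y + z) ^ 2 =
      (w - x) ^ 2 + (w - y) ^ 2 + (w - z) ^ 2 + (x - y) ^ 2 + (x - z) ^ 2 + (y - z) ^ 2 := by ring
  have hnn : 0 ≤ (w - x) ^ 2 + (w - y) ^ 2 + (w - z) ^ 2 + (x - y) ^ 2 + (x - z) ^ 2 + (y - z) ^ 2 := by
    positivity
  linarith

/-- `r⁴ ≤ 8a⁴ + 8b⁴` for `r = b - a`. -/
theorem sub_pow_four_le (a b : ℝ) : (b - a) ^ 4 ≤ 8 * a ^ 4 + 8 * b ^ 4 := by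
  have hr2 : (b - a) ^ 2 ≤ 2 * a ^ 2 + 2 * b ^ 2 := by nlinarith [sq_nonneg (a + b)]
  have h1 : ((b - a) ^ 2) ^ 2 ≤ (2 * a ^ 2 + 2 * b ^ 2) ^ 2 := pow_le_pow_left₀ (sq_nonneg _) hr2 2
  have e1 : (b - a) ^ 4 = ((b - a) ^ 2) ^ 2 := by ring
  have e2 : (2 * a ^ 2 + 2 * b ^ 2) ^ 2 = 8 * a ^ 4 + 8 * b ^ 4 - 4 * (a ^ 2 - b ^ 2) ^ 2 := by ring
  have h3 : 0 ≤ (a ^ 2 - b ^ 2) ^ 2 := sq_nonneg _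
  rw [e1]; rw [e2] at h1; linarith

/-- `r⁸ ≤ 128a⁸ + 128b⁸` for `r = b - a`. -/
theorem sub_pow_eight_le (a b : ℝ) : (b - a) ^ 8 ≤ 128 * a ^ 8 + 128 * b ^ 8 := by
  have hr4 := sub_pow_four_le a b
  have hr4n : 0 ≤ (b - a) ^ 4 := by positivity
  have h1 : ((b - a) ^ 4) ^ 2 ≤ (8 * a ^ 4 + 8 * b ^ 4) ^ 2 := pow_le_pow_left₀ hr4n hr4 2
  have e1 : (b - a) ^ 8 = ((b - a) ^ 4) ^ 2 := by ring
  have e2 : (8 * a ^ 4 + 8 * b ^ 4) ^ 2 = 128 * a ^ 8 + 128 * b ^ 8 - 64 * (a ^ 4 - b ^ 4) ^ 2 := by ring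
  have h3 : 0 ≤ (a ^ 4 - b ^ 4) ^ 2 := sq_nonneg _
  rw [e1]; rw [e2] at h1; linarith

/-- `a⁴ ≤ 1 + a⁸`. -/
theorem pow_four_le_one_add_pow_eight (a : ℝ) : a ^ 4 ≤ 1 + a ^ 8 := by
  have h : 0 ≤ (a ^ 4 - 1) ^ 2 := sq_nonneg _
  have e : (a ^ 4 - 1) ^ 2 = a ^ 8 - 2 * a ^ 4 + 1 := by ring
  have h4 : 0 ≤ a ^ 4 := by positivity
  rw [e] at h; linarith

/-- Pointwise: `(U(a) + V(b - a)/2)² ≤ A · (1 + a⁸ + b⁸)` for the pinned-chain potentials, with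
`A = A(ω₂, lam, β) = 4(ω₂² + lam²) + 2¹⁰(1 + β²)` (generous). -/
theorem potentialEnergy_sq_le (ω₂ lam β γ a b : ℝ) :
    ((pinnedChain ω₂ lam β γ).U a + (pinnedChain ω₂ lam β γ).V (b - a) / 2) ^ 2 ≤
      (4 * (ω₂ ^ 2 + lam ^ 2) + 2 ^ 10 * (1 + β ^ 2)) * (1 + a ^ 8 + b ^ 8) := by
  have hU : (pinnedChain ω₂ lam β γ).U a = ω₂ * a ^ 2 / 2 + lam * a ^ 4 / 4 := rfl
  have hV : (pinnedChain ω₂ lam β γ).V (b - a) = (b - a) ^ 2 / 2 + β * (b - a) ^ 4 / 4 := rfl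
  rw [hU, hV]
  have ha8n : 0 ≤ a ^ 8 := by positivity
  have hb8n : 0 ≤ b ^ 8 := by positivity
  have ha4 := pow_four_le_one_add_pow_eight a
  have hb4 := pow_four_le_one_add_pow_eight b
  have hr4 := sub_pow_four_le a b
  have hr8 := sub_pow_eight_le a b
  have hβ2 : 0 ≤ β ^ 2 := sq_nonneg β
  have hω2 : 0 ≤ ω₂ ^ 2 := sq_nonneg ω₂
  have hl2 : 0 ≤ lam ^ 2 := sq_nonneg lam
  -- `M = 1 + a⁸ + b⁸`
  have hM0 : 0 ≤ 1 + a ^ 8 + b ^ 8 := by positivity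
  -- the four squares
  have t1 : (ω₂ * a ^ 2 / 2) ^ 2 ≤ ω₂ ^ 2 * (1 + a ^ 8 + b ^ 8) := by
    have e : (ω₂ * a ^ 2 / 2) ^ 2 = ω₂ ^ 2 * (a ^ 4 / 4) := by ring
    rw [e]
    exact mul_le_mul_of_nonneg_left (by linarith) hω2
  have t2 : (lam * a ^ 4 / 4) ^ 2 ≤ lam ^ 2 * (1 + a ^ 8 + b ^ 8) := by
    have e : (lam * a ^ 4 / 4) ^ 2 = lam ^ 2 * (a ^ 8 / 16) := by ring
    rw [e]
    exact mul_le_mul_of_nonneg_left (by linarith) hl2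
  have t3 : ((b - a) ^ 2 / 4) ^ 2 ≤ 1 + a ^ 8 + b ^ 8 := by
    have e : ((b - a) ^ 2 / 4) ^ 2 = (b - a) ^ 4 / 16 := by ring
    rw [e]
    linarith
  have t4 : (β * (b - a) ^ 4 / 8) ^ 2 ≤ β ^ 2 * (2 * (1 + a ^ 8 + b ^ 8)) := by
    have e : (β * (b - a) ^ 4 / 8) ^ 2 = β ^ 2 * ((b - a) ^ 8 / 64) := by ring
    rw [e]
    exact mul_le_mul_of_nonneg_left (by linarith) hβ2
  have step := sq_add_four_le (ω₂ * a ^ 2 / 2) (lam * a ^ 4 / 4) ((b - a) ^ 2 / 4) (β * (b - a) ^ 4 / 8)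
  have hfin : 4 * (ω₂ ^ 2 * (1 + a ^ 8 + b ^ 8) + lam ^ 2 * (1 + a ^ 8 + b ^ 8) + (1 + a ^ 8 + b ^ 8) +
      β ^ 2 * (2 * (1 + a ^ 8 + b ^ 8))) ≤ (4 * (ω₂ ^ 2 + lam ^ 2) + 2 ^ 10 * (1 + β ^ 2)) * (1 + a ^ 8 + b ^ 8) := by
    have e : (4 * (ω₂ ^ 2 + lam ^ 2) + 2 ^ 10 * (1 + β ^ 2)) * (1 + a ^ 8 + b ^ 8) -
        4 * (ω₂ ^ 2 * (1 + a ^ 8 + b ^ 8) + lam ^ 2 * (1 + a ^ 8 + b ^ 8) + (1 + a ^ 8 + b ^ 8) +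
          β ^ 2 * (2 * (1 + a ^ 8 + b ^ 8))) =
        1020 * (1 + a ^ 8 + b ^ 8) + 1016 * (β ^ 2 * (1 + a ^ 8 + b ^ 8)) := by ring
    have h2 : 0 ≤ β ^ 2 * (1 + a ^ 8 + b ^ 8) := mul_nonneg hβ2 hM0
    linarith
  calc (ω₂ * a ^ 2 / 2 + lam * a ^ 4 / 4 + ((b - a) ^ 2 / 2 + β * (b - a) ^ 4 / 4) / 2) ^ 2
      = (ω₂ * a ^ 2 / 2 + lam * a ^ 4 / 4 + (b - a) ^ 2 / 4 + β * (b - a) ^ 4 / 8) ^ 2 := by ring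
    _ ≤ 4 * ((ω₂ * a ^ 2 / 2) ^ 2 + (lam * a ^ 4 / 4) ^ 2 + ((b - a) ^ 2 / 4) ^ 2 +
          (β * (b - a) ^ 4 / 8) ^ 2) := step
    _ ≤ 4 * (ω₂ ^ 2 * (1 + a ^ 8 + b ^ 8) + lam ^ 2 * (1 + a ^ 8 + b ^ 8) + (1 + a ^ 8 + b ^ 8) +
          β ^ 2 * (2 * (1 + a ^ 8 + b ^ 8))) := by linarith
    _ ≤ (4 * (ω₂ ^ 2 + lam ^ 2) + 2 ^ 10 * (1 + β ^ 2)) * (1 + a ^ 8 + b ^ 8) := hfin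

/-- **The static stubs compose**: `E_{μ_T^N}[e₀²] ≤ 3T²/2 + 2A(1 + 2C)` for every `N ≥ 2`, from the Gaussian
momentum moment and the uniform position moments (`e₀² ≤ p₀⁴/2 + 2(U + V/2)²`, `integral_mono_of_nonneg`). -/
theorem siteEnergyMoment_le_of_moments {ω₂ lam β γ T : ℝ} (hω : 0 < ω₂) (hl : 0 < lam) (hβ : 0 < β)
    (hT : 0 < T) {C : ℝ} {N : ℕ} (hN : 1 < N)
    (hp : Integrable (fun z : PhaseSpace N => (z.2 ⟨0, Nat.zero_lt_of_lt hN⟩) ^ 4)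
        ((pinnedChain ω₂ lam β γ).gibbsMeasure N T) ∧
      ∫ z, (z.2 ⟨0, Nat.zero_lt_of_lt hN⟩) ^ 4 ∂((pinnedChain ω₂ lam β γ).gibbsMeasure N T) ≤ 3 * T ^ 2)
    (hq : Integrable (fun z : PhaseSpace N => (z.1 ⟨0, Nat.zero_lt_of_lt hN⟩) ^ 8)
          ((pinnedChain ω₂ lam β γ).gibbsMeasure N T) ∧
        Integrable (fun z : PhaseSpace N => (z.1 ⟨1, hN⟩) ^ 8) ((pinnedChain ω₂ lam β γ).gibbsMeasure N T) ∧
        ∫ z, (z.1 ⟨0, Nat.zero_lt_of_lt hN⟩) ^ 8 ∂((pinnedChain ω₂ lam β γ).gibbsMeasure N T) ≤ C ∧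
        ∫ z, (z.1 ⟨1, hN⟩) ^ 8 ∂((pinnedChain ω₂ lam β γ).gibbsMeasure N T) ≤ C) :
    siteEnergyMoment ω₂ lam β γ T N ≤
      3 * T ^ 2 / 2 + 2 * (4 * (ω₂ ^ 2 + lam ^ 2) + 2 ^ 10 * (1 + β ^ 2)) * (1 + C + C) := by
  set μ := (pinnedChain ω₂ lam β γ).gibbsMeasure N T with hμ
  haveI : IsProbabilityMeasure μ :=
    Literature.MathematicalPhysics.KineticTheory.HeatConduction.pinnedChain_isProbabilityMeasure_gibbsMeasure
      hω hl.le hβ.le γ N hT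
  set A : ℝ := 4 * (ω₂ ^ 2 + lam ^ 2) + 2 ^ 10 * (1 + β ^ 2) with hA
  have hA0 : 0 ≤ A := by positivity
  obtain ⟨hp4, hp4le⟩ := hp
  obtain ⟨hq0, hq1, hq0le, hq1le⟩ := hq
  -- the dominating integrable function
  set g : PhaseSpace N → ℝ := fun z =>
    (z.2 ⟨0, Nat.zero_lt_of_lt hN⟩) ^ 4 / 2 +
      2 * (A * (1 + (z.1 ⟨0, Nat.zero_lt_of_lt hN⟩) ^ 8 + (z.1 ⟨1, hN⟩) ^ 8)) with hg
  have hgi : Integrable g μ := by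
    have h1 : Integrable (fun z : PhaseSpace N => (z.2 ⟨0, Nat.zero_lt_of_lt hN⟩) ^ 4 / 2) μ :=
      hp4.div_const 2
    have h2 : Integrable (fun z : PhaseSpace N =>
        2 * (A * (1 + (z.1 ⟨0, Nat.zero_lt_of_lt hN⟩) ^ 8 + (z.1 ⟨1, hN⟩) ^ 8))) μ :=
      ((((integrable_const (1 : ℝ)).add hq0).add hq1).const_mul A).const_mul 2
    exact h1.add h2
  have hpt : ∀ z : PhaseSpace N, (siteEnergy₀ ω₂ lam β γ N z) ^ 2 ≤ g z := by
    intro z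
    simp only [siteEnergy₀, dif_pos hN, hg]
    have hW := potentialEnergy_sq_le ω₂ lam β γ (z.1 ⟨0, Nat.zero_lt_of_lt hN⟩) (z.1 ⟨1, hN⟩)
    set W := (pinnedChain ω₂ lam β γ).U (z.1 ⟨0, Nat.zero_lt_of_lt hN⟩) +
      (pinnedChain ω₂ lam β γ).V (z.1 ⟨1, hN⟩ - z.1 ⟨0, Nat.zero_lt_of_lt hN⟩) / 2 with hWdef
    set x := z.2 ⟨0, Nat.zero_lt_of_lt hN⟩ with hx
    have e : x ^ 2 / 2 + (pinnedChain ω₂ lam β γ).U (z.1 ⟨0, Nat.zero_lt_of_lt hN⟩) +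
        (pinnedChain ω₂ lam β γ).V (z.1 ⟨1, hN⟩ - z.1 ⟨0, Nat.zero_lt_of_lt hN⟩) / 2 = x ^ 2 / 2 + W := by
      rw [hWdef]; ring
    rw [e]
    have h2 : (x ^ 2 / 2 + W) ^ 2 ≤ 2 * (x ^ 2 / 2) ^ 2 + 2 * W ^ 2 := by nlinarith [sq_nonneg (x ^ 2 / 2 - W)]
    have h3 : 2 * (x ^ 2 / 2) ^ 2 = x ^ 4 / 2 := by ring
    rw [← hA] at hW
    linarith
  have hnn : 0 ≤ᵐ[μ] fun z => (siteEnergy₀ ω₂ lam β γ N z) ^ 2 := Eventually.of_forall fun z => sq_nonneg _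
  have hmono : ∫ z, (siteEnergy₀ ω₂ lam β γ N z) ^ 2 ∂μ ≤ ∫ z, g z ∂μ :=
    integral_mono_of_nonneg hnn hgi (Eventually.of_forall hpt)
  have hgval : ∫ z, g z ∂μ =
      (∫ z, (z.2 ⟨0, Nat.zero_lt_of_lt hN⟩) ^ 4 ∂μ) / 2 +
        2 * (A * (1 + ∫ z, (z.1 ⟨0, Nat.zero_lt_of_lt hN⟩) ^ 8 ∂μ + ∫ z, (z.1 ⟨1, hN⟩) ^ 8 ∂μ)) := by
    have h1 : Integrable (fun z : PhaseSpace N => (z.2 ⟨0, Nat.zero_lt_of_lt hN⟩) ^ 4 / 2) μ :=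
      hp4.div_const 2
    have h01 : Integrable (fun z : PhaseSpace N => (1 : ℝ) + (z.1 ⟨0, Nat.zero_lt_of_lt hN⟩) ^ 8) μ :=
      (integrable_const (1 : ℝ)).add hq0
    have h012 : Integrable (fun z : PhaseSpace N =>
        (1 : ℝ) + (z.1 ⟨0, Nat.zero_lt_of_lt hN⟩) ^ 8 + (z.1 ⟨1, hN⟩) ^ 8) μ := h01.add hq1
    have h2 : Integrable (fun z : PhaseSpace N =>
        2 * (A * (1 + (z.1 ⟨0, Nat.zero_lt_of_lt hN⟩) ^ 8 + (z.1 ⟨1, hN⟩) ^ 8))) μ :=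
      (h012.const_mul A).const_mul 2
    rw [hg, integral_add h1 h2, integral_const_mul, integral_const_mul, integral_add h01 hq1,
      integral_add (integrable_const _) hq0, integral_const, integral_div]
    simp
  rw [hgval] at hmono
  unfold siteEnergyMoment
  have hb1 : (∫ z, (z.2 ⟨0, Nat.zero_lt_of_lt hN⟩) ^ 4 ∂μ) / 2 ≤ 3 * T ^ 2 / 2 := by linarith
  have hb2 : A * (1 + ∫ z, (z.1 ⟨0, Nat.zero_lt_of_lt hN⟩) ^ 8 ∂μ + ∫ z, (z.1 ⟨1, hN⟩) ^ 8 ∂μ) ≤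
      A * (1 + C + C) := mul_le_mul_of_nonneg_left (by linarith) hA0
  linarith

/-- **`LocalEnergyMoment` from the two static stubs.** -/
theorem localEnergyMoment_holds : LocalEnergyMoment := by
  intro ω₂ lam β γ hω hl hβ hγ T hT
  obtain ⟨C, hC⟩ := stub_gibbsPositionEighthMoment ω₂ lam β γ hω hl hβ hγ T hT
  refine ⟨3 * T ^ 2 / 2 + 2 * (4 * (ω₂ ^ 2 + lam ^ 2) + 2 ^ 10 * (1 + β ^ 2)) * (1 + C + C), fun N hN => ?_⟩
  have h1 : 1 < N := hN
  exact siteEnergyMoment_le_of_moments hω hl hβ hT h1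
    (stub_gibbsMomentumFourthMoment ω₂ lam β γ hω hl hβ hγ T hT N (Nat.zero_lt_of_lt h1)) (hC N h1)

/-! ## Cross-route bridges (sorry-free; documentation of shared staffing, not used by the composition) -/

/-- Verbatim check: `BoundaryEscapeDeficit.EscapeLaw` is a statement about `escapeDeficit`. -/
example : EscapeLaw ↔ ∀ ω₂ lam β γ : ℝ, 0 < ω₂ → 0 < lam → 0 < β → 0 < γ → ∀ T : ℝ, 0 < T →
    ∃ κb : ℝ, 0 < κb ∧ Filter.Tendsto (fun N : ℕ => ((N : ℝ) - 1) * γ * escapeDeficit ω₂ lam β γ T N)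
      Filter.atTop (nhds κb) := Iff.rfl

/-- Verbatim check: `BoundaryEscapeDeficit.HalfChainTailLaw` is a statement about `stepResponse`. -/
example : HalfChainTailLaw ↔ ∀ ω₂ lam β γ : ℝ, 0 < ω₂ → 0 < lam → 0 < β → 0 < γ → ∀ T : ℝ, 0 < T →
    ∃ c C t₀ : ℝ, 0 < c ∧ 0 < t₀ ∧ ∀ t : ℝ, t₀ ≤ t → ∀ᶠ M : ℕ in Filter.atTop,
      c / Real.sqrt t ≤ 1 - stepResponse ω₂ lam β γ T M t ∧
        1 - stepResponse ω₂ lam β γ T M t ≤ C / Real.sqrt t := Iff.rfl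

/-- `OhmicFloor` from the sibling route's TARGET: a convergent `(N-1) γ E_N` is bounded, hence
`E_N ≤ 2(κ_b + 1)/(γ N)` for large `N`. -/
theorem ohmicFloor_of_escapeLaw (h : EscapeLaw) : OhmicFloor := by
  intro ω₂ lam β γ hω hl hβ hγ T hT
  obtain ⟨κb, hκb, hlim⟩ := h ω₂ lam β γ hω hl hβ hγ T hT
  have hev : ∀ᶠ N : ℕ in atTop, ((N : ℝ) - 1) * γ * escapeDeficit ω₂ lam β γ T N ≤ κb + 1 :=
    (hlim.eventually (Iic_mem_nhds (lt_add_one κb))).mono fun N hN => hN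
  obtain ⟨N₁, hN₁⟩ := eventually_atTop.1 hev
  refine ⟨2 * (κb + 1) / γ, max N₁ 2, fun N hN => ?_⟩
  have hN1 : N₁ ≤ N := le_trans (le_max_left _ _) hN
  have hN2 : 2 ≤ N := le_trans (le_max_right _ _) hN
  have hNr : (2 : ℝ) ≤ N := by exact_mod_cast hN2
  have hb := hN₁ N hN1
  have hpos : 0 < ((N : ℝ) - 1) * γ := mul_pos (by linarith) hγ
  have h1 : escapeDeficit ω₂ lam β γ T N ≤ (κb + 1) / (((N : ℝ) - 1) * γ) := by
    rw [le_div_iff₀ hpos]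
    calc escapeDeficit ω₂ lam β γ T N * (((N : ℝ) - 1) * γ)
        = ((N : ℝ) - 1) * γ * escapeDeficit ω₂ lam β γ T N := by ring
      _ ≤ κb + 1 := hb
  have h2 : (κb + 1) / (((N : ℝ) - 1) * γ) ≤ 2 * (κb + 1) / γ / (N : ℝ) := by
    rw [div_le_div_iff₀ hpos (by positivity)]
    have hk : 0 ≤ κb + 1 := by linarith
    have : (N : ℝ) ≤ 2 * ((N : ℝ) - 1) := by linarith
    calc (κb + 1) * (N : ℝ) ≤ (κb + 1) * (2 * ((N : ℝ) - 1)) := mul_le_mul_of_nonneg_left this hk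
      _ = 2 * (κb + 1) / γ * (((N : ℝ) - 1) * γ) := by field_simp
  exact h1.trans h2

/-- `OhmicFloor` from the UPPER halves of the sibling cruxes: `E_N ≤ C₂ (1 - θ_M(a₀ N²))`
(`DiffusiveCrossover`, upper) and `1 - θ_M(a₀ N²) ≤ C/√(a₀ N²) = C/(√a₀ N)` (`HalfChainTailLaw`, upper) at one
common large `M`; the lower tail is used only to know `1 - θ_M ≥ 0` when absorbing the sign of `C₂`. -/
theorem ohmicFloor_of_tail_crossover (hT' : HalfChainTailLaw) (hX : DiffusiveCrossover) : OhmicFloor := by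
  intro ω₂ lam β γ hω hl hβ hγ T hT
  obtain ⟨c, C, t₀, hc, ht₀, htail⟩ := hT' ω₂ lam β γ hω hl hβ hγ T hT
  obtain ⟨a₀, a₁, c₂, C₂, ha₀, ha₁, hc₂, hcross⟩ := hX ω₂ lam β γ hω hl hβ hγ T hT
  have hNev : ∀ᶠ N : ℕ in atTop, t₀ ≤ a₀ * (N : ℝ) ^ 2 := by
    have : Tendsto (fun N : ℕ => a₀ * (N : ℝ) ^ 2) atTop atTop := by
      apply Tendsto.const_mul_atTop ha₀
      exact (tendsto_pow_atTop two_ne_zero).comp tendsto_natCast_atTop_atTop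
    exact this.eventually_ge_atTop t₀
  obtain ⟨N₁, hN₁⟩ := eventually_atTop.1 (hcross.and hNev)
  refine ⟨max C₂ 0 * (max C 0 / Real.sqrt a₀), max N₁ 1, fun N hN => ?_⟩
  have hNN₁ : N₁ ≤ N := le_trans (le_max_left _ _) hN
  have hN1 : 1 ≤ N := le_trans (le_max_right _ _) hN
  have hNr : (0 : ℝ) < N := by exact_mod_cast hN1
  obtain ⟨hcrossN, htN⟩ := hN₁ N hNN₁
  obtain ⟨M, ⟨-, hup⟩, hlow, htailM⟩ := (hcrossN.and (htail _ htN)).exists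
  have hsq : Real.sqrt (a₀ * (N : ℝ) ^ 2) = Real.sqrt a₀ * (N : ℝ) := by
    rw [Real.sqrt_mul ha₀.le, Real.sqrt_sq hNr.le]
  have hdef0 : 0 ≤ 1 - stepResponse ω₂ lam β γ T M (a₀ * (N : ℝ) ^ 2) :=
    le_trans (div_nonneg hc.le (Real.sqrt_nonneg _)) hlow
  calc escapeDeficit ω₂ lam β γ T N
      ≤ C₂ * (1 - stepResponse ω₂ lam β γ T M (a₀ * (N : ℝ) ^ 2)) := hup
    _ ≤ max C₂ 0 * (1 - stepResponse ω₂ lam β γ T M (a₀ * (N : ℝ) ^ 2)) :=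
        mul_le_mul_of_nonneg_right (le_max_left _ _) hdef0
    _ ≤ max C₂ 0 * (C / Real.sqrt (a₀ * (N : ℝ) ^ 2)) :=
        mul_le_mul_of_nonneg_left htailM (le_max_right _ _)
    _ ≤ max C₂ 0 * (max C 0 / Real.sqrt (a₀ * (N : ℝ) ^ 2)) :=
        mul_le_mul_of_nonneg_left (div_le_div_of_nonneg_right (le_max_left _ _) (Real.sqrt_nonneg _))
          (le_max_right _ _)
    _ = max C₂ 0 * (max C 0 / Real.sqrt a₀) / (N : ℝ) := by
        rw [hsq]; field_simp

/-! ## Composition (sorry-free) -/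

/-- Floor + transient ⇒ the Cesàro deficit bound (the card's consumed form of `DeficitUpperTail`):
`∫₀ᵗ (1 - θ_N) = ∫₀ᵗ (1 - θ_N - E_N) + t E_N ≤ C₂ √t + t C₁/N ≤ (max(C₂,0) + max(C₁,0) √c) √t` on the window
`1 ≤ t ≤ c N²` (where `t/N ≤ √c √t`). If `s ↦ 1 - θ_N(s)` is not interval-integrable both interval integrals
are `0` by convention and the bound is trivial. -/
theorem deficitIntegral_le_of_floor_transient {ω₂ lam β γ T : ℝ} {N : ℕ} {t C₁ C₂ c : ℝ}
    (hN : 0 < N) (ht : 1 ≤ t) (htc : t ≤ c * (N : ℝ) ^ 2) (hc : 0 < c)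
    (hfloor : escapeDeficit ω₂ lam β γ T N ≤ C₁ / (N : ℝ))
    (htrans : transientIntegral ω₂ lam β γ T N t ≤ C₂ * Real.sqrt t) :
    deficitIntegral ω₂ lam β γ T N t ≤ (max C₂ 0 + max C₁ 0 * Real.sqrt c) * Real.sqrt t := by
  have ht0 : 0 ≤ t := le_trans zero_le_one ht
  have hNr : (0 : ℝ) < N := by exact_mod_cast hN
  have hsqrt0 : 0 ≤ Real.sqrt t := Real.sqrt_nonneg _
  have hsqc0 : 0 ≤ Real.sqrt c := Real.sqrt_nonneg _
  -- the window: t / N ≤ √c · √t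
  have hwin : t / (N : ℝ) ≤ Real.sqrt c * Real.sqrt t := by
    have h1 : Real.sqrt t ≤ Real.sqrt c * (N : ℝ) := by
      calc Real.sqrt t ≤ Real.sqrt (c * (N : ℝ) ^ 2) := Real.sqrt_le_sqrt htc
        _ = Real.sqrt c * (N : ℝ) := by
            rw [Real.sqrt_mul hc.le, Real.sqrt_sq hNr.le]
    rw [div_le_iff₀ hNr]
    calc t = Real.sqrt t * Real.sqrt t := (Real.mul_self_sqrt ht0).symm
      _ ≤ Real.sqrt t * (Real.sqrt c * (N : ℝ)) := mul_le_mul_of_nonneg_left h1 hsqrt0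
      _ = Real.sqrt c * Real.sqrt t * (N : ℝ) := by ring
  -- nonnegativity of the target constant times √t
  have htarget0 : 0 ≤ (max C₂ 0 + max C₁ 0 * Real.sqrt c) * Real.sqrt t := by positivity
  by_cases hf : IntervalIntegrable (fun s => 1 - stepResponse ω₂ lam β γ T N s) volume 0 t
  · -- integrable branch: split off the floor
    have hsplit : deficitIntegral ω₂ lam β γ T N t =
        transientIntegral ω₂ lam β γ T N t + t * escapeDeficit ω₂ lam β γ T N := by
      unfold transientIntegral deficitIntegral
      rw [intervalIntegral.integral_sub hf intervalIntegrable_const, intervalIntegral.integral_const,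
        sub_zero, smul_eq_mul]
      ring
    have hfl : t * escapeDeficit ω₂ lam β γ T N ≤ t * (C₁ / (N : ℝ)) :=
      mul_le_mul_of_nonneg_left hfloor ht0
    have hfl' : t * (C₁ / (N : ℝ)) ≤ max C₁ 0 * (Real.sqrt c * Real.sqrt t) := by
      calc t * (C₁ / (N : ℝ)) = C₁ * (t / (N : ℝ)) := by ring
        _ ≤ max C₁ 0 * (t / (N : ℝ)) :=
            mul_le_mul_of_nonneg_right (le_max_left _ _) (div_nonneg ht0 hNr.le)
        _ ≤ max C₁ 0 * (Real.sqrt c * Real.sqrt t) :=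
            mul_le_mul_of_nonneg_left hwin (le_max_right _ _)
    have htr : transientIntegral ω₂ lam β γ T N t ≤ max C₂ 0 * Real.sqrt t :=
      htrans.trans (mul_le_mul_of_nonneg_right (le_max_left _ _) hsqrt0)
    rw [hsplit]
    calc transientIntegral ω₂ lam β γ T N t + t * escapeDeficit ω₂ lam β γ T N
        ≤ max C₂ 0 * Real.sqrt t + max C₁ 0 * (Real.sqrt c * Real.sqrt t) := by linarith
      _ = (max C₂ 0 + max C₁ 0 * Real.sqrt c) * Real.sqrt t := by ring
  · -- junk branch: the interval integral of a non-integrable function is 0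
    have h0 : deficitIntegral ω₂ lam β γ T N t = 0 := intervalIntegral.integral_undef hf
    rw [h0]
    exact htarget0

/-- The four def-level statements give (S) at the bath bond, pointwise in the parameters: for `N ≥ 2` in the
window, `V_N(0,t) ≤ (4γT² (max(C₂,0) + max(C₁,0) √c) + 8 max(σ²,0)) √t` (`√t ≥ 1` absorbs the static term). -/
theorem bondHeatVar_le_of_parts {ω₂ lam β γ T : ℝ} {N : ℕ} {t C₁ C₂ c σ2 : ℝ}
    (hγ : 0 < γ) (hN : 2 ≤ N) (ht : 1 ≤ t) (htc : t ≤ c * (N : ℝ) ^ 2) (hc : 0 < c)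
    (hred : bondHeatVar ω₂ lam β γ T N 0 t ≤
      4 * γ * T ^ 2 * deficitIntegral ω₂ lam β γ T N t + 8 * siteEnergyMoment ω₂ lam β γ T N)
    (hmom : siteEnergyMoment ω₂ lam β γ T N ≤ σ2)
    (hfloor : escapeDeficit ω₂ lam β γ T N ≤ C₁ / (N : ℝ))
    (htrans : transientIntegral ω₂ lam β γ T N t ≤ C₂ * Real.sqrt t) :
    bondHeatVar ω₂ lam β γ T N 0 t ≤
      (4 * γ * T ^ 2 * (max C₂ 0 + max C₁ 0 * Real.sqrt c) + 8 * max σ2 0) * Real.sqrt t := by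
  have hN0 : 0 < N := lt_of_lt_of_le (by norm_num) hN
  have hsqrt : 1 ≤ Real.sqrt t := by
    rw [← Real.sqrt_one]
    exact Real.sqrt_le_sqrt ht
  have hdef := deficitIntegral_le_of_floor_transient (ω₂ := ω₂) (lam := lam) (β := β) (T := T)
    hN0 ht htc hc hfloor htrans
  have hγT : 0 ≤ 4 * γ * T ^ 2 := by positivity
  have h2 : siteEnergyMoment ω₂ lam β γ T N ≤ max σ2 0 * Real.sqrt t :=
    calc siteEnergyMoment ω₂ lam β γ T N ≤ max σ2 0 := hmom.trans (le_max_left _ _)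
      _ = max σ2 0 * 1 := (mul_one _).symm
      _ ≤ max σ2 0 * Real.sqrt t := mul_le_mul_of_nonneg_left hsqrt (le_max_right _ _)
  have h1 := mul_le_mul_of_nonneg_left hdef hγT
  calc bondHeatVar ω₂ lam β γ T N 0 t
      ≤ 4 * γ * T ^ 2 * deficitIntegral ω₂ lam β γ T N t + 8 * siteEnergyMoment ω₂ lam β γ T N := hred
    _ ≤ 4 * γ * T ^ 2 * ((max C₂ 0 + max C₁ 0 * Real.sqrt c) * Real.sqrt t) +
          8 * (max σ2 0 * Real.sqrt t) := by linarith
    _ = (4 * γ * T ^ 2 * (max C₂ 0 + max C₁ 0 * Real.sqrt c) + 8 * max σ2 0) * Real.sqrt t := by ring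

/-- **The skeleton concludes the crux BY NAME.** `SubdiffusiveBondHeat` (route `BondHeatUncertainty`,
stmt-AtomisticToContinuum-9120) from the five registered stubs: witness bond `b = 0`, window constant the `c`
of `stub_transientEW`, threshold `max(N₀, N₀', 2)`; the crux's `let V` is `bondHeatVar` by `rfl`. -/
theorem SubdiffusiveBondHeat_of : SubdiffusiveBondHeat := by
  intro ω₂ lam β γ hω hl hβ hγ T hT
  obtain ⟨σ2, hσ⟩ := localEnergyMoment_holds ω₂ lam β γ hω hl hβ hγ T hT
  obtain ⟨C₁, N₁, hC₁⟩ := ohmicFloor_holds ω₂ lam β γ hω hl hβ hγ T hT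
  obtain ⟨C₂, c, hc, N₂, hC₂⟩ := transientEW_holds ω₂ lam β γ hω hl hβ hγ T hT
  refine ⟨4 * γ * T ^ 2 * (max C₂ 0 + max C₁ 0 * Real.sqrt c) + 8 * max σ2 0, c, hc,
    max (max N₁ N₂) 2, fun N hN => ⟨0, ?_, fun t ht htc => ?_⟩⟩
  · have h2 : 2 ≤ N := le_trans (le_max_right _ _) hN
    omega
  · have h2 : 2 ≤ N := le_trans (le_max_right _ _) hN
    have hN₁ : N₁ ≤ N := le_trans ((le_max_left _ _).trans (le_max_left _ _)) hN
    have hN₂ : N₂ ≤ N := le_trans ((le_max_right _ _).trans (le_max_left _ _)) hN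
    have ht0 : 0 ≤ t := le_trans zero_le_one ht
    have hV := bondHeatVar_le_of_parts hγ h2 ht htc hc
      (bathBondReduction_holds ω₂ lam β γ hω hl hβ hγ T hT N h2 t ht0) (hσ N h2) (hC₁ N hN₁)
      (hC₂ N hN₂ t ht htc)
    exact hV

end Summit.AtomisticToContinuum.FouriersLaw.Cruxes.SubdiffusiveBondHeat.BathBondDeficitIntegral

end
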